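import Summits.CriticalPhenomena.PercolationContinuityZ3.Theorems.PercNearOneGluingNoHeavyLowerTailMajorityGluingTypeTableFixedMIso
import Summits.CriticalPhenomena.PercolationContinuityZ3.Theorems.PercNearOneGluingNoHeavyLowerTailMajorityGluingTypeTableRelabel
import HarnessLib

/-!
# The fixed-`M` programme in the kernel: transport of the symmetric hypotheses along the `S₃` relabelling
(lane prim-rate, constants-miner 1, gen 28; KERNEL-WINDOW.md §3 item 5, §4; NEXT-g29 item 1)

Support file for the closed crux `NoHeavyLowerTail` (stmt-CriticalPhenomena-4575), majority-gluing line; continuation of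
`…TypeTableRelabel` (`relabel σ`, `lin_relabel`, typewise equivariance) and `…TypeTableFixedMIso` (`FMLawB`, `fixedMB_sound`).
For a permutation `σ` of the relays `2,3,4` and a law `x`, the relabelled law is `relaw σ x = x ∘ relabel σ⁻¹`.  This file
proves the transport of every SYMMETRIC hypothesis family of the window programme: the 22 `O`-free rows (closed under
relabelling as functionals on the table, `linFree_closed`), normalisation, the layer / singleton / hub-pair / glued-pair /
support / all-cut masses and the objective at relabelled indices (`Tm_tr`, …, `scalar_tr`), and the isolation and support
masses of the ISO rows for ORDERED index tuples (`hub3_tr`, `rel3_tr`, `hub4_tr`, `inv_tr`), assembled as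
**`SymLaw.transport : SymLaw k M x → SymLaw k M (relaw σ x)`** for the symmetric hypothesis structure `SymLaw` (template A's
symmetric rows + the five power-row families over all ordered tuples + `0 < M ≤ 2^{−k/32}`), and `E_relaw`.  The `24 → 4`
order-class cover is in `…TypeTableFixedMCover`.  No sorries.  [cite: VandenbergHaggstromKahn2005, Thm. 1.3 (p. 6)]
-/

namespace Summit.CriticalPhenomena.PercolationContinuityZ3.Theorems

namespace HubOnly
namespace TypeTable

open DType

noncomputable section

/-! ### The workhorse: transporting a linear functional -/

/-- The relabelled law `x ∘ relabel σ⁻¹`. -/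
def relaw (σ : ℕ × ℕ × ℕ) (x : DType → ℝ) : DType → ℝ := fun τ => x (relabel (invPerm σ) τ)

/-- **Transport.**  If `φ ∘ relabel σ = ψ` on the table then `lin φ (x ∘ relabel σ⁻¹) = lin ψ x`. -/
theorem lin_transport {σ : ℕ × ℕ × ℕ} (hσ : σ ∈ perms3) {φ ψ : DType → ℤ} (h : ∀ τ ∈ allTypes, φ (relabel σ τ) = ψ τ)
    (x : DType → ℝ) : lin φ (relaw σ x) = lin ψ x := by
  unfold relaw
  rw [lin_relabel σ hσ φ x]
  exact lin_congr h x   -- `lin_congr` of …TypeTableBottomRegimeA (imported through …FixedMSupp)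

/-- The relabelled law is nonnegative. -/
theorem relaw_nonneg {σ : ℕ × ℕ × ℕ} {x : DType → ℝ} (hx : ∀ τ, 0 ≤ x τ) : ∀ τ, 0 ≤ relaw σ x τ := fun _ => hx _

/-! ### Index bookkeeping (by `decide`) -/

/-- `appP σ` and `appP σ⁻¹` are inverse on `{1,2,3,4}`, preserve it, and are injective there. -/
theorem appP_facts : ∀ σ ∈ perms3, ∀ z ∈ [1, 2, 3, 4],
    appP σ (appP (invPerm σ) z) = z ∧ appP (invPerm σ) (appP σ z) = z ∧ appP σ z ∈ [1, 2, 3, 4] ∧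
      appP (invPerm σ) z ∈ [1, 2, 3, 4] ∧ (∀ y ∈ [1, 2, 3, 4], appP σ z = appP σ y → z = y) ∧
      (∀ y ∈ [1, 2, 3, 4], z < y → appP σ z ≠ appP σ y) := by
  decide

set_option maxRecDepth 100000 in
/-- The 22 `O`-free rows are closed under relabelling, as functionals on the table (index form). -/
theorem linFree_closed : ∀ σ ∈ perms3, ∀ i ∈ List.range 22, ∃ j ∈ List.range 22,
    ∀ τ ∈ allTypes, (linFree.getD i fun _ => 0) (relabel σ τ) = (linFree.getD j fun _ => 0) τ := by
  decide +kernel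

set_option maxRecDepth 100000 in
/-- Equivariance of `u_{0ab}`, `ρ₀^{0ab}` for ORDERED pairs of distinct relays. -/
theorem relabel_hub3 : ∀ σ ∈ perms3, ∀ τ ∈ allTypes, ∀ a ∈ [1, 2, 3, 4], ∀ b ∈ [1, 2, 3, 4], a ≠ b →
    (relabel σ τ).uB [0, appP σ a, appP σ b] = τ.uB [0, a, b] ∧
      (relabel σ τ).rho [0, appP σ a, appP σ b] 0 = τ.rho [0, a, b] 0 := by
  decide +kernel

set_option maxRecDepth 100000 in
/-- Equivariance of `u_{abc}` for ORDERED triples of distinct relays. -/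
theorem relabel_rel3a : ∀ σ ∈ perms3, ∀ τ ∈ allTypes, ∀ a ∈ [1, 2, 3, 4], ∀ b ∈ [1, 2, 3, 4], ∀ c ∈ [1, 2, 3, 4],
    a ≠ b → a ≠ c → b ≠ c → (relabel σ τ).uB [appP σ a, appP σ b, appP σ c] = τ.uB [a, b, c] := by
  decide +kernel

set_option maxRecDepth 100000 in
/-- Equivariance of `ρ_t^{abc}` for ORDERED triples of distinct relays. -/
theorem relabel_rel3b : ∀ σ ∈ perms3, ∀ τ ∈ allTypes, ∀ a ∈ [1, 2, 3, 4], ∀ b ∈ [1, 2, 3, 4], ∀ c ∈ [1, 2, 3, 4],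
    a ≠ b → a ≠ c → b ≠ c →
      ∀ t ∈ [a, b, c], (relabel σ τ).rho [appP σ a, appP σ b, appP σ c] (appP σ t) = τ.rho [a, b, c] t := by
  decide +kernel

set_option maxRecDepth 100000 in
/-- Equivariance of `u_{0abc}`, `ρ₀^{0abc}` for ORDERED triples of distinct relays. -/
theorem relabel_hub4a : ∀ σ ∈ perms3, ∀ τ ∈ allTypes, ∀ a ∈ [1, 2, 3, 4], ∀ b ∈ [1, 2, 3, 4], ∀ c ∈ [1, 2, 3, 4],
    a ≠ b → a ≠ c → b ≠ c →
    (relabel σ τ).uB [0, appP σ a, appP σ b, appP σ c] = τ.uB [0, a, b, c] ∧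
      (relabel σ τ).rho [0, appP σ a, appP σ b, appP σ c] 0 = τ.rho [0, a, b, c] 0 := by
  decide +kernel

set_option maxRecDepth 100000 in
/-- Equivariance of the relay supports `ρ_t^{0abc}` for ORDERED triples of distinct relays. -/
theorem relabel_hub4b : ∀ σ ∈ perms3, ∀ τ ∈ allTypes, ∀ a ∈ [1, 2, 3, 4], ∀ b ∈ [1, 2, 3, 4], ∀ c ∈ [1, 2, 3, 4],
    a ≠ b → a ≠ c → b ≠ c →
      ∀ t ∈ [a, b, c], (relabel σ τ).rho [0, appP σ a, appP σ b, appP σ c] (appP σ t) = τ.rho [0, a, b, c] t := by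
  decide +kernel

set_option maxRecDepth 100000 in
/-- Equivariance for the invariant index lists `[1,2,3,4]` and `[0,1,2,3,4]`. -/
theorem relabel_inv : ∀ σ ∈ perms3, ∀ τ ∈ allTypes,
    (relabel σ τ).uB [1, 2, 3, 4] = τ.uB [1, 2, 3, 4] ∧ (relabel σ τ).uB [0, 1, 2, 3, 4] = τ.uB [0, 1, 2, 3, 4] ∧
    (relabel σ τ).rho [0, 1, 2, 3, 4] 0 = τ.rho [0, 1, 2, 3, 4] 0 ∧
    ∀ t ∈ [1, 2, 3, 4], (relabel σ τ).rho [0, 1, 2, 3, 4] (appP σ t) = τ.rho [0, 1, 2, 3, 4] t := by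
  decide +kernel

/-! ### Transport of the event masses -/

variable {σ : ℕ × ℕ × ℕ} (hσ : σ ∈ perms3) (x : DType → ℝ)
include hσ

/-- Layer masses: `T_{σz}(x') = T_z(x)`. -/
theorem Tm_tr : ∀ z ∈ [1, 2, 3, 4], Tm (appP σ z) (relaw σ x) = Tm z x := fun z hz =>
  lin_transport hσ (fun τ hτ => by rw [((relabel_events σ hσ τ hτ).1 z hz).2.1]) x

/-- Singleton masses: `S_{σz}(x') = S_z(x)`. -/
theorem Sm_tr : ∀ z ∈ [1, 2, 3, 4], Sm (appP σ z) (relaw σ x) = Sm z x := fun z hz =>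
  lin_transport hσ (fun τ hτ => by rw [((relabel_events σ hσ τ hτ).1 z hz).2.2.1]) x

/-- Hub-pair masses. -/
theorem Cm_tr : ∀ z ∈ [1, 2, 3, 4], ∀ y ∈ [1, 2, 3, 4], Cm (appP σ z) (appP σ y) (relaw σ x) = Cm z y x :=
  fun z hz y hy => lin_transport hσ (fun τ hτ => by rw [(((relabel_events σ hσ τ hτ).1 z hz).2.2.2 y hy).1]) x

/-- Glued-pair masses. -/
theorem Pm_tr : ∀ z ∈ [1, 2, 3, 4], ∀ y ∈ [1, 2, 3, 4], Pm (appP σ z) (appP σ y) (relaw σ x) = Pm z y x :=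
  fun z hz y hy => lin_transport hσ (fun τ hτ => by rw [(((relabel_events σ hσ τ hτ).1 z hz).2.2.2 y hy).2.1]) x

/-- Support masses `π`. -/
theorem Pim_tr : ∀ z ∈ [1, 2, 3, 4], ∀ y ∈ [1, 2, 3, 4], Pim (appP σ z) (appP σ y) (relaw σ x) = Pim z y x :=
  fun z hz y hy => lin_transport hσ (fun τ hτ => by rw [(((relabel_events σ hσ τ hτ).1 z hz).2.2.2 y hy).2.2]) x

/-- All-cut mass, objective, normalisation mass. -/
theorem scalar_tr : ACm (relaw σ x) = ACm x ∧ E (relaw σ x) = E x ∧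
    lin (fun τ => τ.cutZ 1) (relaw σ x) = lin (fun τ => τ.cutZ 1) x :=
  ⟨lin_transport hσ (fun τ hτ => by rw [(relabel_events σ hσ τ hτ).2.1]) x,
   lin_transport hσ (fun τ hτ => (relabel_events σ hσ τ hτ).2.2.1) x,
   lin_transport hσ (fun τ hτ => (relabel_events σ hσ τ hτ).2.2.2) x⟩

/-- The `O`-free rows pass to the relabelled law. -/
theorem linRows_tr (h : ∀ φ ∈ linFree, lin φ x ≤ 0) : ∀ φ ∈ linFree, lin φ (relaw σ x) ≤ 0 := by
  intro φ hφ
  obtain ⟨i, hi, rfl⟩ := List.getElem_of_mem hφ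
  have hlen : linFree.length = 22 := by rfl
  obtain ⟨j, hj, hij⟩ := linFree_closed σ hσ i (by simp [List.mem_range]; omega)
  simp only [List.mem_range] at hj
  have e1 : linFree.getD i (fun _ => 0) = linFree[i] := List.getD_eq_getElem _ _ hi
  have e2 : linFree.getD j (fun _ => 0) = linFree[j]'(by omega) := List.getD_eq_getElem _ _ (by omega)
  rw [← e1, lin_transport hσ hij x, e2]
  exact h _ (List.getElem_mem _)

/-! ### Transport of the isolation and support masses (ordered index tuples) -/

/-- `u_{0,σa,σb}(x') = u_{0ab}(x)` and `ρ₀^{0,σa,σb}(x') = ρ₀^{0ab}(x)`. -/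
theorem hub3_tr : ∀ a ∈ [1, 2, 3, 4], ∀ b ∈ [1, 2, 3, 4], a ≠ b →
    uS [0, appP σ a, appP σ b] (relaw σ x) = uS [0, a, b] x ∧ Rho0 (appP σ a) (appP σ b) (relaw σ x) = Rho0 a b x :=
  fun a ha b hb hab =>
  ⟨lin_transport hσ (fun τ hτ => by
      simp only [DType.uZ]; rw [(relabel_hub3 σ hσ τ hτ a ha b hb hab).1]) x,
   lin_transport hσ (fun τ hτ => by rw [(relabel_hub3 σ hσ τ hτ a ha b hb hab).2]) x⟩

/-- Relay triples: `u_{σa,σb,σc}(x') = u_{abc}(x)` and `ρ^{σS}_{σt}(x') = ρ^{S}_t(x)`. -/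
theorem rel3_tr : ∀ a ∈ [1, 2, 3, 4], ∀ b ∈ [1, 2, 3, 4], ∀ c ∈ [1, 2, 3, 4], a ≠ b → a ≠ c → b ≠ c →
    uS [appP σ a, appP σ b, appP σ c] (relaw σ x) = uS [a, b, c] x ∧
    ∀ t ∈ [a, b, c], lin (fun τ => ind (τ.rho [appP σ a, appP σ b, appP σ c] (appP σ t))) (relaw σ x) =
      lin (fun τ => ind (τ.rho [a, b, c] t)) x :=
  fun a ha b hb c hc hab hac hbc =>
  ⟨lin_transport hσ (fun τ hτ => by
      simp only [DType.uZ]; rw [relabel_rel3a σ hσ τ hτ a ha b hb c hc hab hac hbc]) x,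
   fun t ht => lin_transport hσ (fun τ hτ => by
      rw [relabel_rel3b σ hσ τ hτ a ha b hb c hc hab hac hbc t ht]) x⟩

/-- Hub 4-sets: `u_{0,σa,σb,σc}(x') = u_{0abc}(x)`, `ρ₀` and `ρ_{σt}` transported. -/
theorem hub4_tr : ∀ a ∈ [1, 2, 3, 4], ∀ b ∈ [1, 2, 3, 4], ∀ c ∈ [1, 2, 3, 4], a ≠ b → a ≠ c → b ≠ c →
    uS [0, appP σ a, appP σ b, appP σ c] (relaw σ x) = uS [0, a, b, c] x ∧
    lin (fun τ => ind (τ.rho [0, appP σ a, appP σ b, appP σ c] 0)) (relaw σ x) = lin (fun τ => ind (τ.rho [0, a, b, c] 0)) x ∧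
    ∀ t ∈ [a, b, c], lin (fun τ => ind (τ.rho [0, appP σ a, appP σ b, appP σ c] (appP σ t))) (relaw σ x) =
      lin (fun τ => ind (τ.rho [0, a, b, c] t)) x :=
  fun a ha b hb c hc hab hac hbc =>
  ⟨lin_transport hσ (fun τ hτ => by
      simp only [DType.uZ]; rw [(relabel_hub4a σ hσ τ hτ a ha b hb c hc hab hac hbc).1]) x,
   lin_transport hσ (fun τ hτ => by rw [(relabel_hub4a σ hσ τ hτ a ha b hb c hc hab hac hbc).2]) x,
   fun t ht => lin_transport hσ (fun τ hτ => by
      rw [relabel_hub4b σ hσ τ hτ a ha b hb c hc hab hac hbc t ht]) x⟩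

/-- The invariant sets: `U₄(x') = U₄(x)`, `u_{01234}(x') = u_{01234}(x)`, `ρ₀^{01234}(x') = ρ₀^{01234}(x)`, `ρ_{σt}(x') = ρ_t(x)`. -/
theorem inv_tr : uS [1, 2, 3, 4] (relaw σ x) = uS [1, 2, 3, 4] x ∧ uS [0, 1, 2, 3, 4] (relaw σ x) = uS [0, 1, 2, 3, 4] x ∧
    lin (fun τ => ind (τ.rho [0, 1, 2, 3, 4] 0)) (relaw σ x) = lin (fun τ => ind (τ.rho [0, 1, 2, 3, 4] 0)) x ∧
    ∀ t ∈ [1, 2, 3, 4], lin (fun τ => ind (τ.rho [0, 1, 2, 3, 4] (appP σ t))) (relaw σ x) =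
      lin (fun τ => ind (τ.rho [0, 1, 2, 3, 4] t)) x :=
  ⟨lin_transport hσ (fun τ hτ => by simp only [DType.uZ]; rw [(relabel_inv σ hσ τ hτ).1]) x,
   lin_transport hσ (fun τ hτ => by simp only [DType.uZ]; rw [(relabel_inv σ hσ τ hτ).2.1]) x,
   lin_transport hσ (fun τ hτ => by rw [(relabel_inv σ hσ τ hτ).2.2.1]) x,
   fun t ht => lin_transport hσ (fun τ hτ => by rw [(relabel_inv σ hσ τ hτ).2.2.2 t ht]) x⟩

/-! ### The symmetric hypotheses and their transport -/

omit hσ in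
/-- THE SYMMETRIC HYPOTHESES of the window programme at hub weights `0 < M ≤ 2^{−k/32}` (no case): template A's symmetric rows and
the five power-row families over all ORDERED index tuples. -/
structure SymLaw (k : ℕ) (M : ℝ) (x : DType → ℝ) : Prop where
  /-- nonnegative masses -/
  nonneg : ∀ τ, 0 ≤ x τ
  /-- the 22 `O`-free linear vdBHK rows -/
  linRows : ∀ φ ∈ linFree, lin φ x ≤ 0
  /-- normalisation -/
  norm : lin (fun τ => τ.cutZ 1) x ≤ 1
  /-- hub-pair van den Berg–Kahn rows, all ordered pairs -/
  hub : ∀ a ∈ [1, 2, 3, 4], ∀ b ∈ [1, 2, 3, 4], a ≠ b → Tm a x * Tm b x ≤ Cm a b x * ACm x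
  /-- relay-root rows in reduced form -/
  rel : ∀ r ∈ [1, 2, 3, 4], ∀ z ∈ [1, 2, 3, 4], r ≠ z → (Cm r z x + Pm r z x) * Tm r x ≤ Cm r z x * (Tm r x + Sm r x)
  /-- positive hub weight -/
  Mpos : 0 < M
  /-- the grid bound -/
  Mle : M ≤ (2 : ℝ) ^ (-(k : ℝ) / 32)
  /-- hub ISO₃ rows, all ordered pairs -/
  isoH : ∀ a ∈ [1, 2, 3, 4], ∀ b ∈ [1, 2, 3, 4], a ≠ b →
    uS [0, a, b] x ^ ((3 + Real.sqrt 3) / 2) ≤ M ^ (3 - (3 + Real.sqrt 3) / 2) * Rho0 a b x * Pim a b x * Pim b a x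
  /-- relay ISO₃ rows, all ordered triples -/
  isoR : ∀ a ∈ [1, 2, 3, 4], ∀ b ∈ [1, 2, 3, 4], ∀ c ∈ [1, 2, 3, 4], a ≠ b → a ≠ c → b ≠ c →
    uS [a, b, c] x ^ ((3 + Real.sqrt 3) / 2) ≤
      M ^ (3 - (3 + Real.sqrt 3) / 2) * lin (fun τ => ind (τ.rho [a, b, c] a)) x *
        lin (fun τ => ind (τ.rho [a, b, c] b)) x * lin (fun τ => ind (τ.rho [a, b, c] c)) x
  /-- the ISO₄ row of `{1,2,3,4}` -/
  iso4 : uS [1, 2, 3, 4] x ^ ((3 + Real.sqrt (11 / 3)) / 2) ≤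
    M ^ (4 - (3 + Real.sqrt (11 / 3)) / 2) * (Sm 1 x + Tm 1 x) * (Sm 2 x + Tm 2 x) * (Sm 3 x + Tm 3 x) * (Sm 4 x + Tm 4 x)
  /-- hub ISO₄ rows, all ordered triples -/
  isoH4 : ∀ a ∈ [1, 2, 3, 4], ∀ b ∈ [1, 2, 3, 4], ∀ c ∈ [1, 2, 3, 4], a ≠ b → a ≠ c → b ≠ c →
    uS [0, a, b, c] x ^ ((3 + Real.sqrt (11 / 3)) / 2) ≤
      M ^ (4 - (3 + Real.sqrt (11 / 3)) / 2) * lin (fun τ => ind (τ.rho [0, a, b, c] 0)) x *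
        lin (fun τ => ind (τ.rho [0, a, b, c] a)) x * lin (fun τ => ind (τ.rho [0, a, b, c] b)) x *
        lin (fun τ => ind (τ.rho [0, a, b, c] c)) x
  /-- the ISO₅ row -/
  iso5 : uS [0, 1, 2, 3, 4] x ^ ((5 : ℝ) / 2) ≤
    M ^ ((5 : ℝ) / 2) * lin (fun τ => ind (τ.rho [0, 1, 2, 3, 4] 0)) x * lin (fun τ => ind (τ.rho [0, 1, 2, 3, 4] 1)) x *
      lin (fun τ => ind (τ.rho [0, 1, 2, 3, 4] 2)) x * lin (fun τ => ind (τ.rho [0, 1, 2, 3, 4] 3)) x *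
      lin (fun τ => ind (τ.rho [0, 1, 2, 3, 4] 4)) x

/-- **Transport of the symmetric hypotheses** along `σ`: `SymLaw k M x → SymLaw k M (x ∘ relabel σ⁻¹)`. -/
theorem SymLaw.transport {k : ℕ} {M : ℝ} (L : SymLaw k M x) : SymLaw k M (relaw σ x) := by
  have AP := appP_facts σ hσ
  -- preimage index of an image index
  have pre : ∀ z ∈ [1, 2, 3, 4], ∃ w ∈ [1, 2, 3, 4], appP σ w = z := fun z hz =>
    ⟨appP (invPerm σ) z, (AP z hz).2.2.2.1, (AP z hz).1⟩
  have inj : ∀ w ∈ [1, 2, 3, 4], ∀ v ∈ [1, 2, 3, 4], appP σ w ≠ appP σ v → w ≠ v := fun w _ v _ h e => h (by rw [e])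
  have inj' : ∀ w ∈ [1, 2, 3, 4], ∀ v ∈ [1, 2, 3, 4], w ≠ v → appP σ w ≠ appP σ v :=
    fun w hw v hv h e => h ((AP w hw).2.2.2.2.1 v hv e)
  obtain ⟨hAC, hE, hN⟩ := scalar_tr hσ x
  refine ⟨relaw_nonneg L.nonneg, linRows_tr hσ x L.linRows, by rw [hN]; exact L.norm, ?_, ?_, L.Mpos, L.Mle, ?_, ?_, ?_, ?_, ?_⟩
  · intro a ha b hb hab
    obtain ⟨a₀, ha₀, rfl⟩ := pre a ha; obtain ⟨b₀, hb₀, rfl⟩ := pre b hb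
    have h0 := inj a₀ ha₀ b₀ hb₀ hab
    rw [Tm_tr hσ x a₀ ha₀, Tm_tr hσ x b₀ hb₀, Cm_tr hσ x a₀ ha₀ b₀ hb₀, hAC]
    exact L.hub a₀ ha₀ b₀ hb₀ h0
  · intro r hr z hz hrz
    obtain ⟨r₀, hr₀, rfl⟩ := pre r hr; obtain ⟨z₀, hz₀, rfl⟩ := pre z hz
    have h0 := inj r₀ hr₀ z₀ hz₀ hrz
    rw [Tm_tr hσ x r₀ hr₀, Sm_tr hσ x r₀ hr₀, Cm_tr hσ x r₀ hr₀ z₀ hz₀, Pm_tr hσ x r₀ hr₀ z₀ hz₀]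
    exact L.rel r₀ hr₀ z₀ hz₀ h0
  · intro a ha b hb hab
    obtain ⟨a₀, ha₀, rfl⟩ := pre a ha; obtain ⟨b₀, hb₀, rfl⟩ := pre b hb
    have h0 := inj a₀ ha₀ b₀ hb₀ hab
    obtain ⟨hu, hr⟩ := hub3_tr hσ x a₀ ha₀ b₀ hb₀ h0
    rw [hu, hr, Pim_tr hσ x a₀ ha₀ b₀ hb₀, Pim_tr hσ x b₀ hb₀ a₀ ha₀]
    exact L.isoH a₀ ha₀ b₀ hb₀ h0
  · intro a ha b hb c hc hab hac hbc
    obtain ⟨a₀, ha₀, rfl⟩ := pre a ha; obtain ⟨b₀, hb₀, rfl⟩ := pre b hb; obtain ⟨c₀, hc₀, rfl⟩ := pre c hc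
    have h1 := inj a₀ ha₀ b₀ hb₀ hab; have h2 := inj a₀ ha₀ c₀ hc₀ hac; have h3 := inj b₀ hb₀ c₀ hc₀ hbc
    obtain ⟨hu, hr⟩ := rel3_tr hσ x a₀ ha₀ b₀ hb₀ c₀ hc₀ h1 h2 h3
    rw [hu, hr a₀ (by simp), hr b₀ (by simp), hr c₀ (by simp)]
    exact L.isoR a₀ ha₀ b₀ hb₀ c₀ hc₀ h1 h2 h3
  · obtain ⟨hu, -, -, -⟩ := inv_tr hσ x
    rw [hu]
    have hT := Tm_tr hσ x; have hS := Sm_tr hσ x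
    have key : M ^ (4 - (3 + Real.sqrt (11 / 3)) / 2) * (Sm 1 (relaw σ x) + Tm 1 (relaw σ x)) *
        (Sm 2 (relaw σ x) + Tm 2 (relaw σ x)) * (Sm 3 (relaw σ x) + Tm 3 (relaw σ x)) * (Sm 4 (relaw σ x) + Tm 4 (relaw σ x)) =
        M ^ (4 - (3 + Real.sqrt (11 / 3)) / 2) * (Sm 1 x + Tm 1 x) * (Sm 2 x + Tm 2 x) * (Sm 3 x + Tm 3 x) * (Sm 4 x + Tm 4 x) := by
      simp only [perms3, List.mem_cons, List.not_mem_nil, or_false] at hσ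
      rcases hσ with rfl | rfl | rfl | rfl | rfl | rfl <;>
      · have e1 := hT 1 (by simp); have e2 := hT 2 (by simp); have e3 := hT 3 (by simp); have e4 := hT 4 (by simp)
        have f1 := hS 1 (by simp); have f2 := hS 2 (by simp); have f3 := hS 3 (by simp); have f4 := hS 4 (by simp)
        simp only [appP] at e1 e2 e3 e4 f1 f2 f3 f4
        norm_num at e1 e2 e3 e4 f1 f2 f3 f4
        rw [← e1, ← e2, ← e3, ← e4, ← f1, ← f2, ← f3, ← f4]
        try ring
    rw [key]; exact L.iso4
  · intro a ha b hb c hc hab hac hbc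
    obtain ⟨a₀, ha₀, rfl⟩ := pre a ha; obtain ⟨b₀, hb₀, rfl⟩ := pre b hb; obtain ⟨c₀, hc₀, rfl⟩ := pre c hc
    have h1 := inj a₀ ha₀ b₀ hb₀ hab; have h2 := inj a₀ ha₀ c₀ hc₀ hac; have h3 := inj b₀ hb₀ c₀ hc₀ hbc
    obtain ⟨hu, h0, hr⟩ := hub4_tr hσ x a₀ ha₀ b₀ hb₀ c₀ hc₀ h1 h2 h3
    rw [hu, h0, hr a₀ (by simp), hr b₀ (by simp), hr c₀ (by simp)]
    exact L.isoH4 a₀ ha₀ b₀ hb₀ c₀ hc₀ h1 h2 h3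
  · obtain ⟨-, hu, h0, hr⟩ := inv_tr hσ x
    rw [hu]
    have key : M ^ ((5 : ℝ) / 2) * lin (fun τ => ind (τ.rho [0, 1, 2, 3, 4] 0)) (relaw σ x) *
        lin (fun τ => ind (τ.rho [0, 1, 2, 3, 4] 1)) (relaw σ x) * lin (fun τ => ind (τ.rho [0, 1, 2, 3, 4] 2)) (relaw σ x) *
        lin (fun τ => ind (τ.rho [0, 1, 2, 3, 4] 3)) (relaw σ x) * lin (fun τ => ind (τ.rho [0, 1, 2, 3, 4] 4)) (relaw σ x) =
        M ^ ((5 : ℝ) / 2) * lin (fun τ => ind (τ.rho [0, 1, 2, 3, 4] 0)) x * lin (fun τ => ind (τ.rho [0, 1, 2, 3, 4] 1)) x *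
        lin (fun τ => ind (τ.rho [0, 1, 2, 3, 4] 2)) x * lin (fun τ => ind (τ.rho [0, 1, 2, 3, 4] 3)) x *
        lin (fun τ => ind (τ.rho [0, 1, 2, 3, 4] 4)) x := by
      simp only [perms3, List.mem_cons, List.not_mem_nil, or_false] at hσ
      rcases hσ with rfl | rfl | rfl | rfl | rfl | rfl <;>
      · have e1 := hr 1 (by simp); have e2 := hr 2 (by simp); have e3 := hr 3 (by simp); have e4 := hr 4 (by simp)
        simp only [appP] at e1 e2 e3 e4
        norm_num at e1 e2 e3 e4
        rw [h0, ← e1, ← e2, ← e3, ← e4]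
        try ring
    rw [key]; exact L.iso5

omit hσ in
/-- The objective is invariant: `E(x ∘ relabel σ⁻¹) = E(x)`. -/
theorem E_relaw (hσ : σ ∈ perms3) : E (relaw σ x) = E x := (scalar_tr hσ x).2.1

end

end TypeTable
end HubOnly

end Summit.CriticalPhenomena.PercolationContinuityZ3.Theorems
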